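import Mathlib.RingTheory.MvPolynomial.WeightedHomogeneous
import Mathlib.RingTheory.FiniteType
import Mathlib.RingTheory.RegularLocalRing.Polynomial
import Mathlib.Algebra.Order.Antidiag.Finsupp
import Literature.AlgebraicGeometry.Resolution.AffineBlowupAlgebra
import Literature.AlgebraicGeometry.Resolution.AffineBlowup
import HarnessLib

/-!
# Sub-covers of the blowing up of an affine scheme by the charts of a reduction

Support file for crux stmt-ResolutionOfSingularities-15317 (`FrobeniusLadder.FRationalResolution`), line `redirect`,
lead c5, CONE PROGRAMME (rung 4′ in all dimensions on the Veronese cones `V(n,r) = Spec k[χᵈ : |d| = r]`).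
This file proves the generic SUB-COVER CRITERION for blowing ups `Bl_I(Spec R) = Proj R[It]` of an
affine scheme along `I = (S)`: if every generator `s ∈ S` satisfies `s^(N+1) = gᵢ · q` for some
`i`, some `N` and some `q ∈ I^N` (so the `gᵢ ∈ I` generate a reduction of `I`), then the charts
`D₊(gᵢ t)` already cover `Proj R[It]`.  Indeed a relevant homogeneous prime containing every
`gᵢ t` contains `(s t)^(N+1) = (gᵢ t)(q t^N)`, hence every `s t`, hence every `b t`, `b ∈ I`,
hence the irrelevant ideal `R[It]₊` (`irrelevant_le_span_reesT`) — absurd. [folklore]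
-/

-- single-problem summit: the doubled namespace component is forced
set_option linter.dupNamespace false

noncomputable section

namespace Summit.ResolutionOfSingularities.ResolutionOfSingularities.Theorems.FRationalResolution

open MvPolynomial
open Literature.AlgebraicGeometry.Resolution
open AlgebraicGeometry

section Cones

variable (k : Type) [Field k]

/-- The polynomial ring in `n` variables. -/
local notation3 "MP[" n "]" => MvPolynomial (Fin n) k

/-- The `r`-th Veronese subring of `k[x₁,…,xₙ]`: the `k`-subalgebra generated by the degree-`r` monomials. -/
local notation3 "VR[" n ", " r "]" =>
  Algebra.adjoin k ((fun d : Fin n →₀ ℕ => MvPolynomial.monomial d (1 : k)) ''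
    {d : Fin n →₀ ℕ | Finsupp.degree d = (r : ℕ)})

/-- The vertex ideal of the Veronese cone: spanned by the degree-`r` monomials. -/
local notation3 "VM[" n ", " r "]" =>
  Ideal.span {v : ↥VR[n, r] | ∃ d : Fin n →₀ ℕ, Finsupp.degree d = (r : ℕ) ∧
    (v : MvPolynomial (Fin n) k) = MvPolynomial.monomial d 1}

/-- `(s t)^(N+1) = (g t) · (q t^N)` in `R[It]` whenever `s^(N+1) = g q` with `q ∈ I^N`. [folklore] -/
private theorem reesT_pow_succ_eq {R : Type} [CommRing R] {I : Ideal R} {s g q : R} (hs : s ∈ I)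
    (hg : g ∈ I) {N : ℕ} (hq : q ∈ I ^ N) (hsq : s ^ (N + 1) = g * q) :
    reesT s hs ^ (N + 1) =
      reesT g hg * (⟨Polynomial.monomial N q, reesAlgebra.monomial_mem.mpr hq⟩ : reesAlgebra I) := by
  apply Subtype.ext
  change (Polynomial.monomial 1 s) ^ (N + 1) = Polynomial.monomial 1 g * Polynomial.monomial N q
  rw [Polynomial.monomial_pow, Polynomial.monomial_mul_monomial, hsq, one_mul, add_comm]

/-- An ideal of `R[It]` containing `s t` for all `s` in a generating set `S` of `I` contains
`b t` for every `b ∈ I` (`b ↦ b t` is `R`-linear). [folklore] -/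
private theorem reesT_mem_of_forall_gen {R : Type} [CommRing R] (S : Set R)
    (P : Ideal (reesAlgebra (Ideal.span S)))
    (hS : ∀ s (hs : s ∈ S), reesT (I := Ideal.span S) s (Ideal.subset_span hs) ∈ P)
    (b : R) (hb : b ∈ Ideal.span S) : reesT b hb ∈ P := by
  induction hb using Submodule.span_induction with
  | mem x hx => exact hS x hx
  | zero =>
    have : reesT (I := Ideal.span S) (0 : R) (Submodule.zero_mem _) = 0 := by
      apply Subtype.ext
      change Polynomial.monomial 1 (0 : R) = 0
      rw [map_zero]
    rw [this]
    exact P.zero_mem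
  | add x y hx hy ihx ihy =>
    have : reesT (I := Ideal.span S) (x + y) (Submodule.add_mem _ hx hy) = reesT x hx + reesT y hy := by
      apply Subtype.ext
      change Polynomial.monomial 1 (x + y) = Polynomial.monomial 1 x + Polynomial.monomial 1 y
      rw [map_add]
    rw [this]
    exact P.add_mem ihx ihy
  | smul a x hx ihx =>
    have : reesT (I := Ideal.span S) (a • x) (Submodule.smul_mem _ a hx) =
        algebraMap R (reesAlgebra (Ideal.span S)) a * reesT x hx := by
      apply Subtype.ext
      change Polynomial.monomial 1 (a • x) = Polynomial.C a * Polynomial.monomial 1 x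
      rw [Polynomial.C_mul_monomial, smul_eq_mul]
    rw [this]
    exact P.mul_mem_left _ ihx

/-- **Sub-cover criterion for blowing ups.** Let `I = (S) ⊆ R` and let `gᵢ ∈ I` be elements such
that every generator `s ∈ S` satisfies `s^(N+1) = gᵢ · q` for some `i`, `N` and `q ∈ I^N` (the
`gᵢ` generate a reduction of `I`). Then the charts `D₊(gᵢ t)` cover the blowing up
`Bl_I(Spec R) = Proj R[It]`. Proof: a relevant homogeneous prime `𝔭` containing all `gᵢ t`
contains `(s t)^(N+1) = (gᵢ t)(q t^N)`, hence every `s t` (primality), hence every `b t`,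
`b ∈ I` (linearity), hence `R[It]₊` by `irrelevant_le_span_reesT` — contradicting relevance.
[folklore] -/
theorem stub_affineBlowup_cover_of_pow {R : Type} [CommRing R] (S : Set R) {ι : Type} (g : ι → R)
    (hg : ∀ i, g i ∈ Ideal.span S)
    (hpow : ∀ s ∈ S, ∃ i, ∃ N : ℕ, ∃ q ∈ Ideal.span S ^ N, s ^ (N + 1) = g i * q)
    (p : affineBlowup (Ideal.span S)) :
    ∃ i, p ∈ Proj.basicOpen (reesGrading (Ideal.span S)) (reesT (g i) (hg i)) := by
  by_contra h
  push Not at h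
  -- every `gᵢ t` lies in `𝔭`
  have hgp : ∀ i, reesT (g i) (hg i) ∈ p.asHomogeneousIdeal.toIdeal := fun i => by
    have := h i
    rw [Proj.mem_basicOpen, not_not] at this
    exact this
  -- Step 1: every `s t`, `s ∈ S`, lies in `𝔭`
  have hS : ∀ s (hs : s ∈ S), reesT (I := Ideal.span S) s (Ideal.subset_span hs) ∈
      p.asHomogeneousIdeal.toIdeal := by
    intro s hs
    obtain ⟨i, N, q, hq, hsq⟩ := hpow s hs
    refine p.isPrime.mem_of_pow_mem (N + 1) ?_
    rw [reesT_pow_succ_eq (Ideal.subset_span hs) (hg i) hq hsq]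
    exact Ideal.mul_mem_right _ _ (hgp i)
  -- Step 2 & 3: hence every `b t`, `b ∈ I`, hence the irrelevant ideal
  apply p.not_irrelevant_le
  change (HomogeneousIdeal.irrelevant (reesGrading (Ideal.span S))).toIdeal ≤ p.asHomogeneousIdeal.toIdeal
  refine (irrelevant_le_span_reesT (Ideal.span S)).trans ?_
  rw [Ideal.span_le]
  rintro _ ⟨b, rfl⟩
  exact reesT_mem_of_forall_gen S _ hS b.1 b.2

end Cones

end Summit.ResolutionOfSingularities.ResolutionOfSingularities.Theorems.FRationalResolution

end
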